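import Summits.Ventures.PercRepro.SingleMergeSeven

/-!
# Cyclic-compatible meets of crossing points

For a monotone single-merge map `c : Config S → Setoid (Fin 4)` (the face maps of marked multigraphs)
two crossing points whose four cells run through all three crossing cells *cyclically* —
`c ω = x_i`, `c ωᶜ = x_j`, `c σ = x_j`, `c σᶜ = x_k` with `i, j, k` distinct — have a meet `ω ⊓ σ`
that is the `⊥`-side of a **good** antipodal pair (`c (ω ⊓ σ) = ⊥`, `c (ω ⊓ σ)ᶜ = ⊤`) with **at least two
open edges**: the overlap bound `card_inter_add_two_le` (SingleMergeSeven) applied to `ω` and `σᶜ`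
(cells `x_i ≠ x_k`) leaves at least two edges of `ω` inside `σ`.  Consequently, when all three crossing-pair
types occur, **every crossing point contains a good configuration with at least two open edges**
(`exists_good_two_le_of_crossing`): pick a crossing point of the third colour; one of it or its complement
is cyclic-compatible with the given point.

This is the combinatorial core behind the empirical inequality `b ≤ t₂` (crossing pairs ≤ good
two-element configurations) observed on every single-merge map searched (P4-gen5.md §2, §4).
-/

namespace PercRepro

open Finset

section Meets

variable {S : Type} [Fintype S] [DecidableEq S]

omit [Fintype S] [DecidableEq S] in
/-- The meet of two points of distinct crossing cells has cell `⊥`. -/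
theorem cell_inf_eq_bot_of_cross4 (c : Config S → Setoid (Fin 4)) (hc : Monotone c)
    {ω σ : Config S} {i j : Fin 3} (hij : i ≠ j) (hω : c ω = cross4 i) (hσ : c σ = cross4 j) :
    c (ω ⊓ σ) = ⊥ := by
  apply le_bot_iff.1
  calc c (ω ⊓ σ) ≤ c ω ⊓ c σ := le_inf (hc inf_le_left) (hc inf_le_right)
    _ = ⊥ := by rw [hω, hσ, cross4_inf_eq_bot hij]

omit [Fintype S] [DecidableEq S] in
/-- The join of two points of distinct crossing cells has cell `⊤`. -/
theorem cell_sup_eq_top_of_cross4 (c : Config S → Setoid (Fin 4)) (hc : Monotone c)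
    {ω σ : Config S} {i j : Fin 3} (hij : i ≠ j) (hω : c ω = cross4 i) (hσ : c σ = cross4 j) :
    c (ω ⊔ σ) = ⊤ := by
  apply top_le_iff.1
  calc (⊤ : Setoid (Fin 4)) = cross4 i ⊔ cross4 j := (cross4_sup_eq_top hij).symm
    _ ≤ c (ω ⊔ σ) := by rw [← hω, ← hσ]; exact sup_le (hc le_sup_left) (hc le_sup_right)

/-- **The cyclic meet lemma.** If `ω` has cells `(x_i, x_j)` and `σ` has cells `(x_j, x_k)` with
`i, j, k` distinct, then `ω ⊓ σ` is good (`⊥` with antipode `⊤`) and has at least two open edges. -/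
theorem cyclic_meet (c : Config S → Setoid (Fin 4)) (hc : Monotone c) (hsm : SingleMergeMap c)
    {ω σ : Config S} {i j k : Fin 3} (hij : i ≠ j) (hjk : j ≠ k) (hik : i ≠ k)
    (hω : c ω = cross4 i) (hωc : c ωᶜ = cross4 j) (hσ : c σ = cross4 j) (hσc : c σᶜ = cross4 k) :
    c (ω ⊓ σ) = ⊥ ∧ c (ω ⊓ σ)ᶜ = ⊤ ∧ 2 ≤ (openEdges (ω ⊓ σ)).card := by
  refine ⟨cell_inf_eq_bot_of_cross4 c hc hij hω hσ, ?_, ?_⟩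
  · rw [compl_inf]
    exact cell_sup_eq_top_of_cross4 c hc hjk hωc hσc
  · have h1 := card_inter_add_two_le c hc hsm hik hω hσc
    have h2 := card_sdiff_add_card_inter (openEdges ω) (openEdges σ)
    have h3 : openEdges ω ∩ openEdges σᶜ = openEdges ω \ openEdges σ := by
      rw [openEdges_compl, sdiff_eq]; rfl
    rw [openEdges_inf]
    rw [h3] at h1
    omega

/-- **Every crossing point of a three-type single-merge map contains a good configuration with
at least two open edges.** -/
theorem exists_good_two_le_of_crossing (c : Config S → Setoid (Fin 4)) (hc : Monotone c)
    (hsm : SingleMergeMap c) (h3 : ThreeTypes c) {ω : Config S} {i j : Fin 3} (hij : i ≠ j)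
    (hω : c ω = cross4 i) (hωc : c ωᶜ = cross4 j) :
    ∃ ω' : Config S, ω' ≤ ω ∧ c ω' = ⊥ ∧ c ω'ᶜ = ⊤ ∧ 2 ≤ (openEdges ω').card := by
  -- the third colour
  have hk : ∀ i j : Fin 3, i ≠ j → ∃ k : Fin 3, k ≠ i ∧ k ≠ j := by decide
  obtain ⟨k, hki, hkj⟩ := hk i j hij
  -- a crossing pair of type {j, k}
  obtain ⟨σ, hσ, hσc⟩ := h3 j k hkj.symm
  -- σ has cells (x_j, x_k): cyclic with ω (x_i, x_j)
  obtain ⟨hb, ht, hcard⟩ := cyclic_meet c hc hsm hij hkj.symm hki.symm hω hωc hσ hσc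
  exact ⟨ω ⊓ σ, inf_le_left, hb, ht, hcard⟩

omit [Fintype S] [DecidableEq S] in
/-- Subconfigurations of a good configuration are good: `G` is a down-set. -/
theorem good_of_le_good (c : Config S → Setoid (Fin 4)) (hc : Monotone c) {ω ω' : Config S}
    (h : ω' ≤ ω) (hb : c ω = ⊥) (ht : c ωᶜ = ⊤) : c ω' = ⊥ ∧ c ω'ᶜ = ⊤ := by
  constructor
  · have := hc h
    rw [hb] at this
    exact le_bot_iff.1 this
  · have := hc (compl_le_compl h)
    rw [ht] at this
    exact top_le_iff.1 this

/-- **The eight atoms of a cyclic triple are good.** For crossing points `ω`, `σ`, `τ` with cells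
`(x_i, x_j)`, `(x_j, x_k)`, `(x_k, x_i)` (`i, j, k` distinct) every Boolean atom of `{ω, σ, τ}` —
`ω ⊓ σ ⊓ τ`, `ω ⊓ σ ⊓ τᶜ`, …, `ωᶜ ⊓ σᶜ ⊓ τᶜ` — has cell `⊥` and antipode cell `⊤`. -/
theorem cyclic_triple_atoms_good (c : Config S → Setoid (Fin 4)) (hc : Monotone c)
    (hsm : SingleMergeMap c) {ω σ τ : Config S} {i j k : Fin 3} (hij : i ≠ j) (hjk : j ≠ k)
    (hik : i ≠ k) (hω : c ω = cross4 i) (hωc : c ωᶜ = cross4 j) (hσ : c σ = cross4 j)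
    (hσc : c σᶜ = cross4 k) (hτ : c τ = cross4 k) (hτc : c τᶜ = cross4 i) :
    (c (ω ⊓ σ ⊓ τ) = ⊥ ∧ c (ω ⊓ σ ⊓ τ)ᶜ = ⊤) ∧
    (c (ω ⊓ σ ⊓ τᶜ) = ⊥ ∧ c (ω ⊓ σ ⊓ τᶜ)ᶜ = ⊤) ∧
    (c (ω ⊓ σᶜ ⊓ τ) = ⊥ ∧ c (ω ⊓ σᶜ ⊓ τ)ᶜ = ⊤) ∧
    (c (ω ⊓ σᶜ ⊓ τᶜ) = ⊥ ∧ c (ω ⊓ σᶜ ⊓ τᶜ)ᶜ = ⊤) ∧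
    (c (ωᶜ ⊓ σ ⊓ τ) = ⊥ ∧ c (ωᶜ ⊓ σ ⊓ τ)ᶜ = ⊤) ∧
    (c (ωᶜ ⊓ σ ⊓ τᶜ) = ⊥ ∧ c (ωᶜ ⊓ σ ⊓ τᶜ)ᶜ = ⊤) ∧
    (c (ωᶜ ⊓ σᶜ ⊓ τ) = ⊥ ∧ c (ωᶜ ⊓ σᶜ ⊓ τ)ᶜ = ⊤) ∧
    (c (ωᶜ ⊓ σᶜ ⊓ τᶜ) = ⊥ ∧ c (ωᶜ ⊓ σᶜ ⊓ τᶜ)ᶜ = ⊤) := by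
  -- the six cyclic meets
  have hωσ := cyclic_meet c hc hsm hij hjk hik hω hωc hσ hσc          -- ω ⊓ σ
  have hστ := cyclic_meet c hc hsm hjk hik.symm hij.symm hσ hσc hτ hτc  -- σ ⊓ τ
  have hτω := cyclic_meet c hc hsm hik.symm hij hjk.symm hτ hτc hω hωc  -- τ ⊓ ω
  have hcτ : c τᶜᶜ = cross4 k := by rw [compl_compl]; exact hτ
  have hcσ : c σᶜᶜ = cross4 j := by rw [compl_compl]; exact hσ
  have hcω : c ωᶜᶜ = cross4 i := by rw [compl_compl]; exact hω
  have hσcωc := cyclic_meet c hc hsm hjk.symm hij.symm hik.symm hσc hcσ hωc hcω   -- σᶜ ⊓ ωᶜ : (k,j),(j,i)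
  have hτcσc := cyclic_meet c hc hsm hik hjk.symm hij hτc hcτ hσc hcσ        -- τᶜ ⊓ σᶜ : (i,k),(k,j)
  have hωcτc := cyclic_meet c hc hsm hij.symm hik hjk hωc hcω hτc hcτ        -- ωᶜ ⊓ τᶜ : (j,i),(i,k)
  refine ⟨?_, ?_, ?_, ?_, ?_, ?_, ?_, ?_⟩
  · exact good_of_le_good c hc inf_le_left hωσ.1 hωσ.2.1
  · exact good_of_le_good c hc inf_le_left hωσ.1 hωσ.2.1
  · exact good_of_le_good c hc (le_inf (inf_le_right) (inf_le_left.trans inf_le_left)) hτω.1 hτω.2.1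
  · exact good_of_le_good c hc (le_inf (inf_le_right) (inf_le_left.trans inf_le_right)) hτcσc.1 hτcσc.2.1
  · exact good_of_le_good c hc (le_inf (inf_le_left.trans inf_le_right) inf_le_right) hστ.1 hστ.2.1
  · exact good_of_le_good c hc (le_inf (inf_le_left.trans inf_le_left) inf_le_right) hωcτc.1 hωcτc.2.1
  · exact good_of_le_good c hc (le_inf (inf_le_left.trans inf_le_right) (inf_le_left.trans inf_le_left)) hσcωc.1 hσcωc.2.1
  · exact good_of_le_good c hc (le_inf (inf_le_left.trans inf_le_right) (inf_le_left.trans inf_le_left)) hσcωc.1 hσcωc.2.1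

/-- **Every `x`-point of a three-type single-merge map has at least four open edges** (not only the
crossing points): with a crossing pair `(σ, σᶜ)` of the two other colours, `(P)` bounds the overlap
of `z` with each of `σ`, `σᶜ` by `|z| − 2`. -/
theorem four_le_card_openEdges_of_cross4 (c : Config S → Setoid (Fin 4)) (hc : Monotone c)
    (hsm : SingleMergeMap c) (h3 : ThreeTypes c) {z : Config S} {i : Fin 3} (hz : c z = cross4 i) :
    4 ≤ (openEdges z).card := by
  have hjk : ∀ i : Fin 3, ∃ j k : Fin 3, j ≠ i ∧ k ≠ i ∧ j ≠ k := by decide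
  obtain ⟨j, k, hji, hki, hjk'⟩ := hjk i
  obtain ⟨σ, hσ, hσc⟩ := h3 j k hjk'
  have h1 := card_inter_add_two_le c hc hsm hji.symm hz hσ
  have h2 := card_inter_add_two_le c hc hsm hki.symm hz hσc
  have h3' := card_sdiff_add_card_inter (openEdges z) (openEdges σ)
  have h4 : openEdges z ∩ openEdges σᶜ = openEdges z \ openEdges σ := by
    rw [openEdges_compl, sdiff_eq]; rfl
  rw [h4] at h2
  omega

/-- **Every `x`-point of a three-type single-merge map has at least four closed edges**: a crossing
pair `(σ, σᶜ)` of the two other colours meets the closed edges of `z` in at least two edges each. -/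
theorem card_openEdges_add_four_le_of_cross4 (c : Config S → Setoid (Fin 4)) (hc : Monotone c)
    (hsm : SingleMergeMap c) (h3 : ThreeTypes c) {z : Config S} {i : Fin 3} (hz : c z = cross4 i) :
    (openEdges z).card + 4 ≤ Fintype.card S := by
  have hjk : ∀ i : Fin 3, ∃ j k : Fin 3, j ≠ i ∧ k ≠ i ∧ j ≠ k := by decide
  obtain ⟨j, k, hji, hki, hjk'⟩ := hjk i
  obtain ⟨σ, hσ, hσc⟩ := h3 j k hjk'
  -- |σ ∩ z| + 2 ≤ |σ| and |σᶜ ∩ z| + 2 ≤ |σᶜ|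
  have h1 := card_inter_add_two_le c hc hsm hji hσ hz
  have h2 := card_inter_add_two_le c hc hsm hki hσc hz
  have e1 := card_sdiff_add_card_inter (openEdges σ) (openEdges z)
  have e2 := card_sdiff_add_card_inter (openEdges σᶜ) (openEdges z)
  -- the two differences are disjoint subsets of the closed edges of z
  have hsub : (openEdges σ \ openEdges z) ∪ (openEdges σᶜ \ openEdges z) ⊆ (openEdges z)ᶜ := by
    intro e he
    rw [Finset.mem_union] at he
    rw [Finset.mem_compl]
    rcases he with he | he <;> exact (Finset.mem_sdiff.1 he).2
  have hdisj : Disjoint (openEdges σ \ openEdges z) (openEdges σᶜ \ openEdges z) := by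
    refine Finset.disjoint_of_subset_left Finset.sdiff_subset ?_
    refine Finset.disjoint_of_subset_right Finset.sdiff_subset ?_
    rw [openEdges_compl]
    exact disjoint_compl_right
  have hcard := Finset.card_le_card hsub
  rw [Finset.card_union_of_disjoint hdisj, Finset.card_compl] at hcard
  have hz_le : (openEdges z).card ≤ Fintype.card S := Finset.card_le_univ _
  omega

end Meets

end PercRepro
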